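import Summits.AtomisticToContinuum.Crystallization.Theorems.FrustratedLawDichotomyStrainedPatchHomValueT2TrackClass
import Summits.AtomisticToContinuum.Crystallization.Theorems.FrustratedLawDichotomyStrainedPatchHomValueT2SoundB

/-!
# (I1) bookkeeping for the K-edition member report (`…HomValueT2TrackClass` §19): ★ `memberOK_sound` — the member's box lies in the class box
# (critic row 1674 (B) (I1) docket item 4; 27623 `(H) HomFloor`, hcp half; decomp-a2c hand-1 g49)

`memberOK K c w' = true` ⟹ every `(U, ξ)` of the member box `(c, w')` (entries `|U_ab − c_ab/SC| ≤ w'_ab/SC`, shuffle `|ξ_i − c_i/SC| ≤ w'_i/SC`) lies in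
the class box `(K.cK, K.wK)` — so every enclosure certified on the class box (`sup_box ≤ sup_K`) applies to the member.  [arithmetic: triangle inequality]
No definitions; 0 sorry; standard axioms.  `--supports stmt-AtomisticToContinuum-27623`.
-/

noncomputable section

namespace Summit.AtomisticToContinuum.Crystallization.Theorems.FrustratedLawDichotomyStrainedPatchHomValueT2Kit

open Literature.Analysis.ValidatedNumerics.Numerics
open Summit.AtomisticToContinuum.Crystallization.Theorems.ChargedEnergyGapNegative (E3)

/-- One coordinate: `|c − cK| + w' ≤ wK` (integers) and `|x − c/SC| ≤ w'/SC` ⟹ `|x − cK/SC| ≤ wK/SC`. [arithmetic] -/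
theorem abs_sub_le_of_member {x : ℝ} {c cK w' wK : ℤ} (h : |c - cK| + w' ≤ wK) (hx : |x - (c : ℝ) / SC| ≤ (w' : ℝ) / SC) :
    |x - (cK : ℝ) / SC| ≤ (wK : ℝ) / SC := by
  have hS := SC_pos
  have hz : |(c : ℝ) - cK| + w' ≤ wK := by exact_mod_cast h
  have t := abs_sub_le x ((c : ℝ) / SC) ((cK : ℝ) / SC)
  have e : |(c : ℝ) / SC - (cK : ℝ) / SC| = |(c : ℝ) - cK| / SC := by rw [← sub_div, abs_div, abs_of_pos hS]
  rw [e] at t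
  have k := div_le_div_of_nonneg_right hz hS.le
  rw [add_div] at k
  linarith

/-- ★ **`memberOK` IS SOUND**: the member's track product box lies inside the class track product box. [arithmetic] -/
theorem memberOK_sound {K : ClassData} {c w' : (Fin 3 × Fin 3) ⊕ Fin 3 → ℤ} (h : memberOK K c w' = true) (U : E3 →L[ℝ] E3) (ξ : E3)
    (hbox : ∀ ab : Fin 3 × Fin 3, |(U (EuclideanSpace.single ab.2 (1 : ℝ))) ab.1 - (c (Sum.inl ab) : ℝ) / SC| ≤ (w' (Sum.inl ab) : ℝ) / SC)
    (hξ : ∀ i : Fin 3, |ξ i - (c (Sum.inr i) : ℝ) / SC| ≤ (w' (Sum.inr i) : ℝ) / SC) :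
    (∀ ab : Fin 3 × Fin 3, |(U (EuclideanSpace.single ab.2 (1 : ℝ))) ab.1 - (K.cK (Sum.inl ab) : ℝ) / SC| ≤ (K.wK (Sum.inl ab) : ℝ) / SC) ∧
      (∀ i : Fin 3, |ξ i - (K.cK (Sum.inr i) : ℝ) / SC| ≤ (K.wK (Sum.inr i) : ℝ) / SC) := by
  unfold memberOK at h
  simp only [Bool.and_eq_true, decide_eq_true_eq] at h
  exact ⟨fun ab => abs_sub_le_of_member (h.1 ab) (hbox ab), fun i => abs_sub_le_of_member (h.2 i) (hξ i)⟩

end Summit.AtomisticToContinuum.Crystallization.Theorems.FrustratedLawDichotomyStrainedPatchHomValueT2Kit
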